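import Literature.AlgebraicGeometry.Resolution.RegularImpliesSmooth
import Literature.AlgebraicGeometry.Resolution.SmoothUniformizationProofs
import Literature.AlgebraicGeometry.Resolution.SeparatingTranscendenceBasis
import Literature.AlgebraicGeometry.Resolution.PurelyInseparableBaseChange
import Mathlib.RingTheory.Localization.BaseChange
import Mathlib.RingTheory.Smooth.Locus
import Mathlib.RingTheory.Flat.Basic
import Mathlib.FieldTheory.PurelyInseparable.Basic
import HarnessLib

/-!
# Smooth points under a purely inseparable extension of the constant field

Topic: `Literature/AlgebraicGeometry/Resolution`. Auxiliary commutative algebra for Step 4 of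
the proof of Temkin's Thm. 4.1.1 (M. Temkin, *Inseparable local uniformization*, J. Algebra 373
(2013) 65–119 = arXiv:0804.1554v3, p. 49): "Then (the new) `yᵢ` is `l`-smooth by the
construction and `xᵢ` is still smooth-equivalent to `yᵢ` by Lemma 2.8.5 … In particular, `x₁`
is `l`-smooth, and, replacing `l` with a purely inseparable extension, we can also arrange that
`x₁` is a simple `l`-smooth point." The step "in particular, `x₁` is `l`-smooth" is descent of
smoothness along a smooth cover (The Stacks Project, Tag 05B5, vendored as the named fact
`Stacks05B5`, not discharged). We avoid it: regularity (instead of smoothness) is transported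
along smooth morphisms by EGA IV₄ 17.5.8 (iii) (`Grothendieck1967_17_5_8_holds`, PROVED in
`SmoothUniformizationProofs.lean`), and after a finite purely inseparable extension `l′/l` of
the constants which makes the residue field separable, regularity is upgraded to smoothness by
the converse of "smooth ⇒ regular" (`isSmoothAt_of_isRegularLocalRing_of_formallySmooth_residueField`,
`RegularImpliesSmooth.lean`, Stacks 00TV). Everything here is PROVED:

* `isSmoothAt_baseChange` — smoothness at a prime is stable under base change `T ⊗_R −`.
* `exists_pow_mem_range_includeRight`, `eq_of_comap_includeRight_eq`,
  `exists_prime_comap_includeRight_eq` — for `l′/l` purely inseparable, `Spec(l′ ⊗_l A) → Spec A`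
  is bijective (radicial and integral).
* `isRegularLocalRing_baseChange_of_smooth_cover` — if `Z = Spec D → X = Spec A` is smooth
  (`A` of finite type over the field `l`), `Z` is `l`-smooth at `z`, and `x` is the image of
  `z`, then `l′ ⊗_l A` is REGULAR at the prime over `x` (`l′ ⊗ D` is `l′`-smooth, hence
  regular, at a prime over `z`; EGA IV 17.5.8 for the smooth morphism `l′ ⊗ D → l′ ⊗ A`).
* `isSmoothAt_baseChange_of_smooth_cover` — … and `l′`-SMOOTH there as soon as the residue
  field is formally smooth over `l′` (Stacks 00TV).
* `exists_algEquiv_of_compositum` — the compositum of a field `κ ⊇ l` with a purely inseparable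
  `l₀/l` is unique up to unique isomorphism (it is `(κ ⊗_l l₀)_red`).
* `exists_purelyInseparable_formallySmooth_compositum` — for `κ/l` finitely generated there is
  a finite purely inseparable `l₀/l` such that EVERY compositum `κ·l₀` is formally smooth
  (= separable) over `l₀` (the classical separating-transcendence-basis theorem,
  `exists_purelyInseparable_isSeparablyGenerated`, made realization-independent).

## Sources

* M. Temkin, *Inseparable local uniformization*, arXiv:0804.1554v3, proof of Thm. 4.1.1, Step 4
  (p. 49).
* A. Grothendieck, *EGA IV₄*, Prop. 17.5.8 (iii); The Stacks Project, Tags 00TV, 05B5.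

## Conventions

Base change to `l′` is Mathlib's `l′ ⊗[l] A` (new constants on the LEFT, an `l′`-algebra by
`Algebra.TensorProduct.leftAlgebra`); primes are pulled back to `A` along
`Algebra.TensorProduct.includeRight`.
-/

noncomputable section

namespace Literature.AlgebraicGeometry.Resolution

universe u

open IsLocalRing TensorProduct

/-! ### Smoothness at a prime is stable under base change -/

/-- **Base change of smoothness at a point**: if the finitely presented `R`-algebra `S` is
smooth at the prime `q` and `Q` is a prime of `T ⊗_R S` lying over `q`, then `T ⊗_R S` is
`T`-smooth at `Q` (`S_f` smooth for some `f ∉ q`, and `T ⊗ S_f = (T ⊗ S)_{1 ⊗ f}`).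
[folklore] -/
theorem isSmoothAt_baseChange {R S : Type*} [CommRing R] [CommRing S] [Algebra R S]
    [Algebra.FinitePresentation R S] (T : Type*) [CommRing T] [Algebra R T]
    (q : Ideal S) [q.IsPrime] [Algebra.IsSmoothAt R q]
    (Q : Ideal (T ⊗[R] S)) [Q.IsPrime]
    (hQ : Q.comap (Algebra.TensorProduct.includeRight (R := R) (A := T) :
      S →ₐ[R] T ⊗[R] S).toRingHom = q) :
    Algebra.IsSmoothAt T Q := by
  obtain ⟨f, hfq, hsm⟩ := Algebra.IsSmoothAt.exists_notMem_smooth R q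
  haveI := hsm
  let C := Localization.Away ((1 : T) ⊗ₜ[R] f)
  have hmap : (Submonoid.powers f).map
      (Algebra.TensorProduct.includeRight (R := R) (A := T) : S →ₐ[R] T ⊗[R] S) =
      Submonoid.powers ((1 : T) ⊗ₜ[R] f) := Submonoid.map_powers _ f
  haveI : IsLocalization ((Submonoid.powers f).map
      (Algebra.TensorProduct.includeRight (R := R) (A := T) : S →ₐ[R] T ⊗[R] S)) C := by
    rw [hmap]; infer_instance
  let e : T ⊗[R] Localization.Away f ≃ₐ[T] C :=
    IsLocalization.tensorProductEquivOfMapIncludeRight R T (.powers f) (Localization.Away f) C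
  haveI : Algebra.Smooth T C := .of_equiv e
  have hQf : (1 : T) ⊗ₜ[R] f ∉ Q := fun h => hfq (by rw [← hQ]; exact h)
  exact Algebra.basicOpen_subset_smoothLocus_iff_smooth.mpr ‹Algebra.Smooth T C›
    (show (⟨Q, ‹_›⟩ : PrimeSpectrum (T ⊗[R] S)) ∈
      (PrimeSpectrum.basicOpen ((1 : T) ⊗ₜ[R] f) : Set _) from hQf)

/-! ### Purely inseparable extension of the constants: a radicial base change -/

section Radicial

variable {l l' : Type u} [Field l] [Field l'] [Algebra l l']

/-- For `l′/l` purely inseparable and any `l`-algebra `A`, every element of `l′ ⊗_l A` has a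
`qⁿ`-th power in (the image of) `A`, `q` the exponential characteristic. (Mathlib's
`IsPurelyInseparable.exists_pow_pow_mem_range_tensorProduct_of_expChar`, moved to the other
side of the tensor product.) [folklore] -/
theorem exists_pow_mem_range_includeRight [IsPurelyInseparable l l'] (A : Type u) [CommRing A]
    [Algebra l A] (q : ℕ) [ExpChar l q] (z : l' ⊗[l] A) :
    ∃ n : ℕ, z ^ q ^ n ∈
      (Algebra.TensorProduct.includeRight (R := l) (A := l') : A →ₐ[l] l' ⊗[l] A).range := by
  let e : l' ⊗[l] A ≃ₐ[l] A ⊗[l] l' := Algebra.TensorProduct.comm l l' A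
  obtain ⟨n, a, ha⟩ :=
    IsPurelyInseparable.exists_pow_pow_mem_range_tensorProduct_of_expChar (R := A) q (e z)
  refine ⟨n, a, e.injective ?_⟩
  rw [map_pow, ← ha]
  change e ((1 : l') ⊗ₜ[l] a) = algebraMap A (A ⊗[l] l') a
  rw [Algebra.TensorProduct.algebraMap_apply, Algebra.algebraMap_self, RingHom.id_apply]
  exact Algebra.TensorProduct.comm_tmul (R := l) (1 : l') a

/-- For `l′/l` purely inseparable, a prime of `l′ ⊗_l A` is determined by its contraction to
`A` (`Spec(l′ ⊗_l A) → Spec A` is injective: radicial). [folklore] -/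
theorem eq_of_comap_includeRight_eq [IsPurelyInseparable l l'] {A : Type u} [CommRing A]
    [Algebra l A] {P₁ P₂ : Ideal (l' ⊗[l] A)} [P₁.IsPrime] [P₂.IsPrime]
    (h : P₁.comap (Algebra.TensorProduct.includeRight (R := l) (A := l') :
        A →ₐ[l] l' ⊗[l] A).toRingHom =
      P₂.comap (Algebra.TensorProduct.includeRight (R := l) (A := l') :
        A →ₐ[l] l' ⊗[l] A).toRingHom) :
    P₁ = P₂ := by
  letI : Algebra A (l' ⊗[l] A) := Algebra.TensorProduct.rightAlgebra
  obtain ⟨q, hq⟩ := ExpChar.exists l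
  refine eq_of_isPrime_of_comap_eq_of_forall_pow_mem (A := A) (q := q) (expChar_pos l q)
    (fun z => ?_) h
  obtain ⟨n, a, ha⟩ := exists_pow_mem_range_includeRight A q z
  exact ⟨n, a, ha⟩

/-- For `l′/l` purely inseparable, every prime of `A` is the contraction of a prime of
`l′ ⊗_l A` (`Spec(l′ ⊗_l A) → Spec A` is surjective: the extension is integral and injective).
[folklore] -/
theorem exists_prime_comap_includeRight_eq [IsPurelyInseparable l l'] (A : Type u) [CommRing A]
    [Algebra l A] (p : Ideal A) [p.IsPrime] :
    ∃ P : Ideal (l' ⊗[l] A), P.IsPrime ∧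
      P.comap (Algebra.TensorProduct.includeRight (R := l) (A := l') :
        A →ₐ[l] l' ⊗[l] A).toRingHom = p := by
  letI : Algebra A (l' ⊗[l] A) := Algebra.TensorProduct.rightAlgebra
  obtain ⟨q, hq⟩ := ExpChar.exists l
  haveI : Algebra.IsIntegral A (l' ⊗[l] A) := by
    refine ⟨fun z => ?_⟩
    obtain ⟨n, a, ha⟩ := exists_pow_mem_range_includeRight A q z
    refine IsIntegral.of_pow (expChar_pow_pos l q n) ?_
    rw [← ha]
    exact isIntegral_algebraMap
  have hker : RingHom.ker (algebraMap A (l' ⊗[l] A)) ≤ p := by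
    have hinj : Function.Injective (algebraMap A (l' ⊗[l] A)) :=
      Algebra.TensorProduct.includeRight_injective (algebraMap l l').injective
    rw [(RingHom.injective_iff_ker_eq_bot _).mp hinj]
    exact bot_le
  obtain ⟨P, -, hP, hPp⟩ :=
    Ideal.exists_ideal_over_prime_of_isIntegral p (⊥ : Ideal (l' ⊗[l] A))
      (by rw [← RingHom.ker_eq_comap_bot]; exact hker)
  exact ⟨P, hP, hPp⟩

end Radicial

/-! ### Regularity and smoothness after a purely inseparable extension of the constants -/

section SmoothCover

variable (l l' : Type u) [Field l] [Field l'] [Algebra l l'] [IsPurelyInseparable l l']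
  (X : Type u) [CommRing X] [Algebra l X] [Algebra.FiniteType l X]
  (D : Type u) [CommRing D] [Algebra X D] [Algebra l D] [IsScalarTower l X D]
  [Algebra.Smooth X D]
  (r : Ideal D) [r.IsPrime] [Algebra.IsSmoothAt l r]

/-- **Regularity at the image of a smooth point of a smooth cover, after enlarging the
constants** (Temkin 2013, proof of Thm. 4.1.1, Step 4, p. 49, the point behind "In particular,
`x₁` is `l`-smooth": there, descent of smoothness along the smooth cover `Z → X`; here its
regularity shadow, which suffices once the constants are enlarged). Let `X = Spec A` be of
finite type over the field `l`, `Z = Spec D → X` smooth, `z ∈ Z` a point at which `Z` is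
`l`-smooth, `x` its image, and `l′/l` purely inseparable. Then `X_{l′} = Spec(l′ ⊗_l A)` is
REGULAR at its (unique) point `x′` over `x`. Proof: `Z_{l′} → X_{l′}` is smooth (base change),
`Z_{l′}` is `l′`-smooth at a point `z′` over `z` (`isSmoothAt_baseChange`), hence regular there
(smooth over a field ⇒ regular, `isRegularLocalRing_of_isSmoothAt`), and regularity descends
along the smooth morphism `Z_{l′} → X_{l′}` (EGA IV₄ 17.5.8 (iii), `Grothendieck1967_17_5_8_holds`)
to the image of `z′`, which is `x′` (radiciality). [cite: Grothendieck1967, Prop. 17.5.8 (iii)] -/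
theorem isRegularLocalRing_baseChange_of_smooth_cover
    (x' : Ideal (l' ⊗[l] X)) [x'.IsPrime]
    (hx' : x'.comap (Algebra.TensorProduct.includeRight (R := l) (A := l') :
        X →ₐ[l] l' ⊗[l] X).toRingHom = r.comap (algebraMap X D)) :
    IsRegularLocalRing (Localization.AtPrime x') := by
  classical
  let φ : X →ₐ[l] D := IsScalarTower.toAlgHom l X D
  let ψ : l' ⊗[l] X →ₐ[l'] l' ⊗[l] D := Algebra.TensorProduct.map (AlgHom.id l' l') φ
  letI : Algebra (l' ⊗[l] X) (l' ⊗[l] D) := ψ.toRingHom.toAlgebra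
  haveI : IsScalarTower l' (l' ⊗[l] X) (l' ⊗[l] D) :=
    IsScalarTower.of_algebraMap_eq fun c => (ψ.commutes c).symm
  have hψ : ∀ a : X, algebraMap (l' ⊗[l] X) (l' ⊗[l] D) ((1 : l') ⊗ₜ[l] a) =
      (1 : l') ⊗ₜ[l] (algebraMap X D a) := fun a => by
    change ψ ((1 : l') ⊗ₜ[l] a) = _
    simp [ψ, φ]
  -- `l′ ⊗ D` is smooth over `l′ ⊗ X` (pasting of pushouts)
  haveI : Algebra.Smooth (l' ⊗[l] X) (l' ⊗[l] D) := by
    letI : Algebra X (l' ⊗[l] X) := Algebra.TensorProduct.rightAlgebra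
    letI : Algebra D (l' ⊗[l] D) := Algebra.TensorProduct.rightAlgebra
    letI : Algebra X (l' ⊗[l] D) :=
      ((algebraMap D (l' ⊗[l] D)).comp (algebraMap X D)).toAlgebra
    haveI : IsScalarTower X D (l' ⊗[l] D) := IsScalarTower.of_algebraMap_eq fun _ => rfl
    haveI : IsScalarTower X (l' ⊗[l] X) (l' ⊗[l] D) :=
      IsScalarTower.of_algebraMap_eq fun a => (hψ a).symm
    haveI : IsScalarTower l D (l' ⊗[l] D) := IsScalarTower.of_algebraMap_eq fun c =>
      ((Algebra.TensorProduct.includeRight (R := l) (A := l') : D →ₐ[l] l' ⊗[l] D).commutes c).symm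
    haveI : IsScalarTower l X (l' ⊗[l] X) := IsScalarTower.of_algebraMap_eq fun c =>
      ((Algebra.TensorProduct.includeRight (R := l) (A := l') : X →ₐ[l] l' ⊗[l] X).commutes c).symm
    haveI : IsScalarTower l (l' ⊗[l] X) (l' ⊗[l] D) := IsScalarTower.of_algebraMap_eq fun c => by
      rw [IsScalarTower.algebraMap_apply l l' (l' ⊗[l] X),
        IsScalarTower.algebraMap_apply l l' (l' ⊗[l] D)]
      exact (ψ.commutes _).symm
    have h1 : Algebra.IsPushout l D l' (l' ⊗[l] D) := inferInstance
    have h2 : Algebra.IsPushout X D (l' ⊗[l] X) (l' ⊗[l] D) :=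
      (Algebra.IsPushout.comp_iff (R := l) (S := X) (T := D) (R' := l') (S' := l' ⊗[l] X)
        (T' := l' ⊗[l] D)).mp h1
    haveI := h2.symm
    exact Algebra.Smooth.of_equiv (Algebra.IsPushout.equiv X (l' ⊗[l] X) D (l' ⊗[l] D))
  -- a prime `r′` of `l′ ⊗ D` over `r`; its image is `x′`
  obtain ⟨r', hr'prime, hr'⟩ := exists_prime_comap_includeRight_eq (l := l) (l' := l') D r
  haveI := hr'prime
  have hcomm : (algebraMap (l' ⊗[l] X) (l' ⊗[l] D)).comp
      (Algebra.TensorProduct.includeRight (R := l) (A := l') : X →ₐ[l] l' ⊗[l] X).toRingHom =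
      (Algebra.TensorProduct.includeRight (R := l) (A := l') : D →ₐ[l] l' ⊗[l] D).toRingHom.comp
        (algebraMap X D) := RingHom.ext fun a => hψ a
  have hx'' : (r'.comap (algebraMap (l' ⊗[l] X) (l' ⊗[l] D))).comap
      (Algebra.TensorProduct.includeRight (R := l) (A := l') : X →ₐ[l] l' ⊗[l] X).toRingHom =
      r.comap (algebraMap X D) := by
    rw [Ideal.comap_comap, hcomm, ← Ideal.comap_comap, hr']
  have heq : r'.comap (algebraMap (l' ⊗[l] X) (l' ⊗[l] D)) = x' :=
    eq_of_comap_includeRight_eq (hx''.trans hx'.symm)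
  subst heq
  -- `l′ ⊗ D` is `l′`-smooth at `r′`, hence regular there
  haveI : Algebra.FinitePresentation l X := (Algebra.FinitePresentation.of_finiteType).mp ‹_›
  haveI : Algebra.FinitePresentation l D := .trans l X D
  haveI : Algebra.IsSmoothAt l' r' := isSmoothAt_baseChange l' r r' hr'
  haveI : IsRegularLocalRing (Localization.AtPrime r') :=
    isRegularLocalRing_of_isSmoothAt l' (l' ⊗[l] D) r'
  -- EGA IV 17.5.8 (iii) for the smooth morphism `l′ ⊗ D → l′ ⊗ X`
  haveI : IsNoetherianRing (l' ⊗[l] X) := Algebra.FiniteType.isNoetherianRing l' _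
  have hft : Algebra.FiniteType (l' ⊗[l] X) (l' ⊗[l] D) := inferInstance
  have hsm : Algebra.IsSmoothAt (l' ⊗[l] X) r' := by
    change Algebra.FormallySmooth (l' ⊗[l] X) (Localization.AtPrime r')
    infer_instance
  exact (Grothendieck1967_17_5_8_holds (l' ⊗[l] X) (l' ⊗[l] D) hft r' hsm).mp ‹_›

/-- **… and smoothness, once the residue field is separable** (Temkin 2013, proof of Thm. 4.1.1,
Step 4, p. 49: "replacing `l` with a purely inseparable extension, we can also arrange that `x₁`
is a simple `l`-smooth point"): in the situation of
`isRegularLocalRing_baseChange_of_smooth_cover`, if moreover the residue field of `x′` is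
formally smooth (separable) over `l′`, then `X_{l′}` is `l′`-smooth at `x′` (Stacks 00TV,
`isSmoothAt_of_isRegularLocalRing_of_formallySmooth_residueField`).
[cite: Temkin2013, proof of Thm. 4.1.1 Step 4 (arXiv:0804.1554v3 p. 49)] -/
theorem isSmoothAt_baseChange_of_smooth_cover
    (x' : Ideal (l' ⊗[l] X)) [x'.IsPrime]
    (hx' : x'.comap (Algebra.TensorProduct.includeRight (R := l) (A := l') :
        X →ₐ[l] l' ⊗[l] X).toRingHom = r.comap (algebraMap X D))
    [Algebra.FormallySmooth l' (ResidueField (Localization.AtPrime x'))] :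
    Algebra.IsSmoothAt l' x' := by
  haveI := isRegularLocalRing_baseChange_of_smooth_cover l l' X D r x' hx'
  haveI : Algebra.FinitePresentation l X := (Algebra.FinitePresentation.of_finiteType).mp ‹_›
  haveI : Algebra.FinitePresentation l' (l' ⊗[l] X) := inferInstance
  exact isSmoothAt_of_isRegularLocalRing_of_formallySmooth_residueField l' (l' ⊗[l] X) x'

end SmoothCover

/-! ### Composita with a purely inseparable extension of the constants -/

section Compositum

/-- **The compositum of `κ ⊇ l` with a purely inseparable `l₀/l` is unique**: two fields `F₁`,
`F₂` receiving compatible maps from `κ` and `l₀` and generated over `κ` by the image of `l₀`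
are isomorphic over `l₀` (and `κ`) — both are `(κ ⊗_l l₀)_red`, the kernel of the surjection
`κ ⊗_l l₀ → Fᵢ` being the nilradical (`ker_compositumLift_eq_nilradical`). [folklore] -/
theorem exists_algEquiv_of_compositum (l l₀ κ F₁ F₂ : Type*) [Field l] [Field l₀] [Field κ]
    [Field F₁] [Field F₂] [Algebra l l₀] [IsPurelyInseparable l l₀] [Algebra l κ]
    [Algebra κ F₁] [Algebra l₀ F₁] [Algebra l F₁] [IsScalarTower l κ F₁] [IsScalarTower l l₀ F₁]
    [Algebra κ F₂] [Algebra l₀ F₂] [Algebra l F₂] [IsScalarTower l κ F₂] [IsScalarTower l l₀ F₂]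
    (h₁ : Algebra.adjoin κ (Set.range (algebraMap l₀ F₁)) = ⊤)
    (h₂ : Algebra.adjoin κ (Set.range (algebraMap l₀ F₂)) = ⊤) :
    ∃ e : F₁ ≃ₐ[l₀] F₂, ∀ a : κ, e (algebraMap κ F₁ a) = algebraMap κ F₂ a := by
  let φ₁ := compositumLift l κ l₀ F₁
  let φ₂ := compositumLift l κ l₀ F₂
  have hs₁ : Function.Surjective φ₁ := compositumLift_surjective_of_adjoin_eq_top h₁
  have hs₂ : Function.Surjective φ₂ := compositumLift_surjective_of_adjoin_eq_top h₂
  have hs₁' : Function.Surjective (φ₁ : κ ⊗[l] l₀ →+* F₁) := hs₁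
  have hs₂' : Function.Surjective (φ₂ : κ ⊗[l] l₀ →+* F₂) := hs₂
  have hker : RingHom.ker (φ₁ : κ ⊗[l] l₀ →+* F₁) = RingHom.ker (φ₂ : κ ⊗[l] l₀ →+* F₂) := by
    rw [ker_compositumLift_eq_nilradical (algebraMap κ F₁).injective,
      ker_compositumLift_eq_nilradical (algebraMap κ F₂).injective]
  let E : F₁ ≃+* F₂ :=
    (RingHom.quotientKerEquivOfSurjective hs₁').symm.trans
      ((Ideal.quotEquivOfEq hker).trans (RingHom.quotientKerEquivOfSurjective hs₂'))
  have hE : ∀ z, E (φ₁ z) = φ₂ z := fun z => by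
    simp only [E, RingEquiv.trans_apply]
    change (RingHom.quotientKerEquivOfSurjective hs₂') ((Ideal.quotEquivOfEq hker)
      ((RingHom.quotientKerEquivOfSurjective hs₁').symm ((φ₁ : κ ⊗[l] l₀ →+* F₁) z))) = _
    rw [RingHom.quotientKerEquivOfSurjective_symm_apply, Ideal.quotEquivOfEq_mk,
      RingHom.quotientKerEquivOfSurjective_apply_mk]
    rfl
  have hl₀ : ∀ c : l₀, E (algebraMap l₀ F₁ c) = algebraMap l₀ F₂ c := fun c => by
    have e1 : algebraMap l₀ F₁ c = φ₁ ((1 : κ) ⊗ₜ[l] c) := by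
      simp [φ₁]
    have e2 : algebraMap l₀ F₂ c = φ₂ ((1 : κ) ⊗ₜ[l] c) := by
      simp [φ₂]
    rw [e1, hE, e2]
  refine ⟨AlgEquiv.ofRingEquiv (f := E) hl₀, fun a => ?_⟩
  have e1 : algebraMap κ F₁ a = φ₁ (a ⊗ₜ[l] (1 : l₀)) := by simp [φ₁]
  have e2 : algebraMap κ F₂ a = φ₂ (a ⊗ₜ[l] (1 : l₀)) := by simp [φ₂]
  change E (algebraMap κ F₁ a) = _
  rw [e1, hE, e2]

/-- **Separability after a finite purely inseparable extension of the constants, for every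
realization of the compositum**: for a finitely generated field extension `κ/l` there is a
finite purely inseparable extension `l₀/l` such that every compositum `κ·l₀` (a field generated
over `κ` by a compatible image of `l₀`) is formally smooth — i.e. separable — over `l₀`. This is
"the classical theorem on existence of separable transcendence basis" in the form used by
Temkin 2013 (proof of Thm. 4.1.1, p. 47 and Step 4, p. 49), via
`exists_purelyInseparable_isSeparablyGenerated` and the uniqueness of composita.
[cite: Temkin2013, proof of Thm. 4.1.1 (arXiv:0804.1554v3 pp. 47, 49)] -/
theorem exists_purelyInseparable_formallySmooth_compositum (l κ : Type u) [Field l] [Field κ]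
    [Algebra l κ] (hfg : (⊤ : IntermediateField l κ).FG) :
    ∃ (l₀ : Type u) (_ : Field l₀) (_ : Algebra l l₀),
      FiniteDimensional l l₀ ∧ IsPurelyInseparable l l₀ ∧
      ∀ (F : Type u) [Field F] [Algebra κ F] [Algebra l₀ F] [Algebra l F] [IsScalarTower l κ F]
        [IsScalarTower l l₀ F], Algebra.adjoin κ (Set.range (algebraMap l₀ F)) = ⊤ →
        Algebra.FormallySmooth l₀ F := by
  obtain ⟨L, _, _, _, _, -, -, l₀, hl₀fin, hl₀pi, hadj, -, hFS⟩ :=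
    exists_purelyInseparable_isSeparablyGenerated l κ hfg
  haveI := hl₀pi
  haveI := hFS
  refine ⟨l₀, inferInstance, inferInstance, hl₀fin, hl₀pi, fun F _ _ _ _ _ _ hgen => ?_⟩
  have hL : Algebra.adjoin κ (Set.range (algebraMap l₀ L)) = ⊤ := by
    have hrange : Set.range (algebraMap l₀ L) = (l₀ : Set L) := by
      ext x
      constructor
      · rintro ⟨y, rfl⟩
        exact y.2
      · intro hx
        exact ⟨⟨x, hx⟩, rfl⟩
    rw [hrange]
    have halg : ∀ x ∈ (l₀ : Set L), IsAlgebraic κ x := fun x hx => by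
      have h1 : IsAlgebraic l (⟨x, hx⟩ : l₀) := Algebra.IsAlgebraic.isAlgebraic _
      have h2 : IsAlgebraic l x := IntermediateField.isAlgebraic_iff.mp h1
      exact h2.tower_top (L := κ)
    rw [← IntermediateField.adjoin_toSubalgebra_of_isAlgebraic halg, hadj,
      IntermediateField.top_toSubalgebra]
  obtain ⟨e, -⟩ := exists_algEquiv_of_compositum l l₀ κ L F hL hgen
  exact Algebra.FormallySmooth.of_equiv e

end Compositum

end Literature.AlgebraicGeometry.Resolution

end
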